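import Summits.Schanuel.Schanuel.Theorems.RootDecomp1KHeightGrading03

/-!
# RootDecomp1KHeightGrading — continuation (RootDecomp1KHeightGrading04): member bookkeeping for the thin-fibre
catalogue (census v47 Table 13; no credit; crit GO L2581)

Census-1 gen 22, ×0 RECORD (no lens credit, no census credit).  Three named curves that occur in the K-line files as
boundary / control / witness members are in fact DECIDED hypothesis-free by theorems already in the tree; this file
states that by name so that no successor treats them as open (COSTUME-CENSUS v47, Table 13 rows TM20 / TM21 / TM4;
kernel-checked as a census scratch first, census/tools/gen22/scratch_B17P.lean, crit verified L2581):

* `thinFibreAt_B17P` — node 12's height-grading BOUNDARY member `B17P = Y² − 17x` (`deg_Y = 2 = 2·xdeg`) lies in node 2's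
  class `XLinearGap2` (`A = Y²`, `B = −17`), hence `ThinFibreAt m₀ B17P` for EVERY `m₀` — the «boundary» is a boundary of
  the height grading only;
* `thinFibreAt_N2P` — node 12's control member `N2P = Y² − 2x²` (prime over `ℚ`, not geometrically irreducible) has the
  CONSTANT top x-coefficient `−2` (no root in `ℚ₂`) of order `e = 2`, so `RootlessTop 2 N2P` and `ThinFibreAt m₀ N2P` for
  every `m₀ ≥ 3`;
* `thinFibreAt_cuspP` — node 2's witness `cuspP = Y³ − x²` (outside `XLinearLt`) is, up to the unit `−1`, the two-term
  curve `x²·1 − Y³`, and the x-lacunary degree ladder (`thinFibreAt_twoTermP`, `3 < 2·m₀`) decides it at every `m₀ ≥ 2`.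

Rung 0 — nothing here proves Schanuel, 33364, 33363, 31077 or `ThinFibre 2`.
-/

noncomputable section

namespace Summit.Schanuel.Schanuel.Theorems.RootDecomp1KHeightGrading

open Polynomial
open Summit.Schanuel.Schanuel.Theorems.RootDecomp1KDegreeLadder
open Summit.Schanuel.Schanuel.Theorems.RootDecomp1KXLinear
open Summit.Schanuel.Schanuel.Theorems.RootDecomp1KXTop
open Summit.Schanuel.Schanuel.Theorems.RootDecomp1KXAll
open Summit.Schanuel.Schanuel.Theorems.RootDecomp1KLevelFinite

/-- member bookkeeping (census v47 Table 13, row TM20; no credit; crit GO L2581): the height-grading boundary member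
`B17P = Y² − 17x` lies in node 2's class `XLinearGap2` (`A = Y²`, `B = −17`), hence is decided hypothesis-free at EVERY
quality: `(m₀ : ℕ) : ThinFibreAt m₀ B17P`. -/
theorem thinFibreAt_B17P (m₀ : ℕ) : ThinFibreAt m₀ B17P := by
  rw [B17P, xPolyP_one]
  refine thinFibreAt_of_xLinearGap2 ⟨_, _, ?_, ?_, rfl⟩ m₀
  · rw [b17C_one, neg_ne_zero]; exact Polynomial.C_ne_zero.mpr (by norm_num)
  · rw [b17C_one, b17C_of_ne (by norm_num : (0:ℕ) ≠ 1), natDegree_neg, natDegree_C, natDegree_X_pow]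

/-- member bookkeeping (census v47 Table 13, row TM21; no credit; crit GO L2581): the non-member `N2P = Y² − 2x²` has a
CONSTANT top x-coefficient (`−2`, no root in `ℚ₂`) of order `e = 2`, so `RootlessTop 2 N2P` and the tree decides it
hypothesis-free at every `m₀ ≥ 3`: `(hm : 3 ≤ m₀) : ThinFibreAt m₀ N2P`. -/
theorem thinFibreAt_N2P {m₀ : ℕ} (hm : 3 ≤ m₀) : ThinFibreAt m₀ N2P := by
  refine thinFibreAt_of_rootlessTop (e := 2) ⟨2, n2C, ?_, ?_, rfl⟩ (by omega)
  · intro j hj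
    interval_cases j
    · rw [n2C_zero, n2C_two, natDegree_neg, natDegree_C, natDegree_X_pow]
    · rw [n2C_one, n2C_two, natDegree_zero]; omega
  · intro z hz
    rw [n2C_two, map_neg, aeval_C, neg_eq_zero] at hz
    norm_num at hz

/-- member bookkeeping (census v47 Table 13, row TM4; no credit; crit GO L2581): node 2's witness curve `cuspP = Y³ − x²`
(outside `XLinearLt`) is, up to the unit `−1`, the two-term curve `x²·1 − Y³`; the x-LACUNARY DEGREE LADDER decides it
hypothesis-free at every `m₀ ≥ 2` (`3 < 2·m₀`): `(hm : 2 ≤ m₀) : ThinFibreAt m₀ cuspP`. -/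
theorem thinFibreAt_cuspP {m₀ : ℕ} (hm : 2 ≤ m₀) : ThinFibreAt m₀ cuspP := by
  have h : cuspP = (-1 : ℤ[X][X]) * twoTermP 2 1 (X ^ 3) := by
    rw [cuspP, twoTermP, Polynomial.map_one, one_mul, Polynomial.map_pow, map_X]; ring
  rw [h]
  refine thinFibreAt_mul_left _ _ (fun x x' y => by simp [bev]) ?_
  exact thinFibreAt_twoTermP (by norm_num) 1 (X ^ 3) (by
    rw [twoTermP, Polynomial.map_one, one_mul, Polynomial.map_pow, map_X]
    calc (C (X ^ 2 : ℤ[X]) - (X : ℤ[X][X]) ^ 3).natDegree ≤ 3 := by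
          refine (natDegree_sub_le _ _).trans ?_
          rw [natDegree_C, natDegree_X_pow]; norm_num
      _ < 2 * m₀ := by omega)

end Summit.Schanuel.Schanuel.Theorems.RootDecomp1KHeightGrading

end
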